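import Mathlib
import HarnessLib
import Literature.Computability.QuantumComplexity.StabilizerRank

/-!
# The exact stabilizer rank of magic-state powers is at least linear
# (Peleg–Shpilka–Volk 2022, Thm. 1.1)

Topic `Literature/Computability/QuantumComplexity`; ONE named fact (result in print,
`def … : Prop`, D-0014) requested by the grounding of route `QuantumAdvantage/AmplitudeProofs`,
cruxes `Summit.QuantumAdvantage.QuantumAdvantage.Theses.AmplitudeProofs.ApcMagicRankExponential`
(`χ(|T⟩^{⊗t}) ≥ (1+ε)^t`) and `…ApcPrefixRankSuperpoly`, support `…ApcOfMagicRank`: the printed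
UNCONDITIONAL lower bound on the EXACT stabilizer rank of `|T⟩^{⊗n}`.

Where the neighbouring printed results live in the tree (do not re-add them):
* the CONDITIONAL superpolynomial bound, Mehraban–Tahmasbi 2024 Thm. 1.6 ("the exact rank of
  `|T⟩^{⊗m}` is super-polynomial unless the permanent has polynomial circuits", rendered
  `(∃ c, ∀ m, χ ≤ m^c + c) → P^{#P} ⊆ P/poly`) is
  `MehrabanTahmasbi2024_PSharpP_subset_PPoly_of_stabilizerRank_poly` in
  `StabilizerRankPermanent.lean`;
* the APPROXIMATE-rank record, Mehraban–Tahmasbi 2024 Thm. 3.1 (`χ_δ(|T⟩^{⊗m}) = Ω(m²/polylog m)`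
  for `0 < δ < 1`), is `MehrabanTahmasbi2024_approxRank_magicT_quadratic` in
  `ApproxStabilizerRankQuadratic.lean` — via `χ_δ ≤ χ` (`approxStabilizerRank_le_stabilizerRank`)
  it also yields an `Ω̃(m²)` exact bound eventually, so the fact below is the printed EXACT-rank
  theorem as such, not the numerical record;
* upper bounds: `χ(|T⟩^{⊗6}) ≤ 7`, `χ(|T⟩^{⊗t}) ≤ 2^{⌈t/2⌉}`, `≤ 7^{⌈t/6⌉}` are DISCHARGED in
  `CliffordSimulator.lean` / `MagicStatePairs.lean`; the printed record is `O(2^{0.3963 t})`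
  (Qassim–Pashayan–Gosset 2021).

Peleg–Shpilka–Volk, *Lower bounds on stabilizer rank*, Quantum 6 (2022) 652 = arXiv:2106.03214
(held text read, pp. 4, 5, 6, 8): **Theorem 1.1** (= Thm. 3.2) "`χ(|T⟩^{⊗n}) = Ω(n)`, and
similarly `χ(|H⟩^{⊗n}) = Ω(n)`" (the two states are Clifford-equivalent up to a phase, p. 5, so the
bound is one statement; it improves Bravyi–Smith–Smolin's `Ω(√n)`). §1.5 (p. 6): "we are
unfortunately unable to prove super-polynomial or even super-linear lower bounds … our techniques
seem incapable of proving super-linear lower bounds", and p. 5: a super-linear bound would give a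
super-linear lower bound for representing the mod-8 indicator functions as sums of
`(−1)^{quadratic}` — an open problem of its own (Williams 2018) — the printed BARRIER for the
route's rank cruxes. Reproved by Labib 2022 (higher-order Fourier analysis) and Lovitz–Steffan
2022.

## Rendering (the fact is implied by the printed theorem)

`Ω(n)` conservatively: `∃ c > 0, ∃ n₀, ∀ n ≥ n₀, c·n ≤ χ(|T⟩^{⊗n})`, over the tree's
`stabilizerRank (tensorPow magicT n)` (`magicT = T H |0⟩ = (|0⟩ + e^{iπ/4}|1⟩)/√2`).

## References

* [PelegShpilkaVolk2022] arXiv:2106.03214, Thm. 1.1 / Thm. 3.2, §1.4–1.5.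
* [MehrabanTahmasbi2024] arXiv:2305.10277, Thm. 1.6, Thm. 3.1 (in the sibling files above).
* [Labib2022] Quantum 6, 645; Lovitz–Steffan, Quantum 6 (2022) 692; Qassim–Pashayan–Gosset,
  Quantum 5 (2021) 606 [QassimPashayanGosset2021].
-/

noncomputable section

namespace Literature.Computability.QuantumComplexity

/-- **Peleg–Shpilka–Volk 2022, Theorem 1.1** (exact stabilizer rank of magic-state powers is at
least linear): `χ(|T⟩^{⊗n}) = Ω(n)`. Rendered: there are `c > 0` and `n₀` with
`c · n ≤ χ(|T⟩^{⊗n})` for all `n ≥ n₀`. PSV22 §1.5: super-linear bounds are open and out of reach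
of the method; benchmark for
`Summit.QuantumAdvantage.QuantumAdvantage.Theses.AmplitudeProofs.ApcMagicRankExponential`.
[cite: PelegShpilkaVolk2022, Thm. 1.1 (= Thm. 3.2, arXiv pp. 4, 8)] -/
def PelegShpilkaVolk2022_stabilizerRank_magicT_linear : Prop :=
  ∃ c : ℝ, 0 < c ∧ ∃ n₀ : ℕ, ∀ n : ℕ, n₀ ≤ n →
    c * (n : ℝ) ≤ (stabilizerRank (tensorPow magicT n) : ℝ)

end Literature.Computability.QuantumComplexity

end
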